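import Mathlib

/-!
# The 2-adic reduction: a golden-ratio dependency in characteristic 0 forces a dependency at `ω ∈ 𝔽₄` (LEMMA R₂, golden case)

Helper file for crux `stmt-CriticalPhenomena-4575` (`NoHeavyLowerTail`, route `PercNearOneGluingNoHeavy`), new-inequality factory
seat `prim-ineq-gen-3` (gen 28).  Everything here is PROVED; no definitions.

Notation (memo `run/shared/lean/prim/prim-ineq-gen-3/CONJECTURE-P2F2.md`): for a finite family `𝒜` with difference family
`D = 𝒜 \\ 𝒜` the PENCIL rows at `t` are `A ↦ (E ↦ [E ⊆ A] + t [E ∩ A = ∅])` (`E ∈ D`).  CONJECTURE (C0) says they are independent for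
every `t ≠ ±1` of characteristic `0`; the golden ratio `t² = t + 1` is the first open class.  CONJECTURE CR(2)@ω says that over a field of
characteristic `2` containing `ω` with `ω² = ω + 1` (a primitive cube root of unity, `𝔽₄ ⊆ F`) the pencil rows at `ω` are independent
for EVERY family — a pure parity statement about three-colourings of `𝒜`.

* `int_golden_eq_zero` — `p² + pq − q² = 0` over `ℤ` forces `p = q = 0` (parity descent); `int_eq_zero_of_golden` — hence
  `p + q t = 0` in a field of characteristic `0` with `t² = t + 1` forces `p = q = 0`.
* `exists_charTwo_dependency_of_integral_dependency` — ★ if `A ↦ a_A + b_A t` (`a, b` integer vectors, not both zero) is a dependency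
  of the pencil at a golden `t` in characteristic `0`, then the pencil at `ω` has a non-zero dependency over `F`
  [the dependency splits along `{1, t}` into two INTEGER identities per column; divide `(a, b)` by `2` until some coordinate is odd
  (descent on `∑ |a_A| + |b_A|`); reduce mod `2`: `A ↦ ā_A + b̄_A ω` is a dependency at `ω`, non-zero since `1, ω` are independent
  over `𝔽₂`].
* `exists_int_add_int_mul_of_mem_adjoin` — every element of `ℤ[t]` is `a + b t`.
* `linearIndependent_pencil_golden_of_charTwo` — ★★ LEMMA R₂ (golden case): if the pencil rows of `𝒜` at `ω` are independent over
  `F` (characteristic `2`, `ω² = ω + 1`) then the pencil rows at every golden `t` (`t² = t + 1`) over every field of characteristic `0`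
  are independent [a dependency over `K` descends to `ℤ[t] ⊆ K` by `linearIndependent_algebraMap_comp_iff`, then the previous theorem].
So CONJECTURE CR(2)@ω (equivalently: no relation 3-cycle `a → b → a+b → a` over `𝔽₂`) implies (C0) for the golden class, and every
machine certificate 'rank_{𝔽₄} U(ω) = |𝒜|' certifies the golden ratio for that family.  (prim-ineq-gen-3 gen 28, 2026-08-25.)
-/

namespace Summit.CriticalPhenomena.PercolationContinuityZ3.Theorems

namespace OrderedDifferences

open Finset
open scoped FinsetFamily

variable {α : Type*} [DecidableEq α]

/-- Parity: `p² + pq − q² = 0` over `ℤ` forces `p` and `q` even. -/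
theorem two_dvd_of_golden (p q : ℤ) (h : p * p + p * q - q * q = 0) : 2 ∣ p ∧ 2 ∣ q := by
  have key : ∀ x y : ZMod 2, x * x + x * y - y * y = 0 → x = 0 ∧ y = 0 := by decide
  have h2 : ((p : ZMod 2)) * (p : ZMod 2) + (p : ZMod 2) * (q : ZMod 2) - (q : ZMod 2) * (q : ZMod 2) = 0 := by
    have e := congrArg (fun z : ℤ => (z : ZMod 2)) h
    simpa using e
  obtain ⟨hp, hq⟩ := key _ _ h2
  exact ⟨(ZMod.intCast_zmod_eq_zero_iff_dvd p 2).mp hp, (ZMod.intCast_zmod_eq_zero_iff_dvd q 2).mp hq⟩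

/-- **No rational golden ratio.**  `p² + pq − q² = 0` over `ℤ` forces `p = q = 0` (divide by `2` for ever). -/
theorem int_golden_eq_zero (p q : ℤ) (h : p * p + p * q - q * q = 0) : p = 0 ∧ q = 0 := by
  suffices H : ∀ n : ℕ, ∀ p q : ℤ, p.natAbs ≤ n → p * p + p * q - q * q = 0 → p = 0 by
    have hp : p = 0 := H _ p q le_rfl h
    subst hp
    refine ⟨rfl, ?_⟩
    have : q * q = 0 := by linear_combination -h
    exact mul_self_eq_zero.mp this
  intro n
  induction n with
  | zero =>
    intro p q hle _
    omega
  | succ n ih =>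
    intro p q hle h
    by_contra hp0
    obtain ⟨⟨p', hp'⟩, ⟨q', hq'⟩⟩ := two_dvd_of_golden p q h
    subst hp' hq'
    have h' : p' * p' + p' * q' - q' * q' = 0 := by
      have e : (4 : ℤ) * (p' * p' + p' * q' - q' * q') = 0 := by linear_combination h
      rcases mul_eq_zero.mp e with e | e
      · norm_num at e
      · exact e
    have hlt : p'.natAbs ≤ n := by omega
    have := ih p' q' hlt h'
    omega

/-- In a field of characteristic `0`, an element with `t * t = t + 1` is irrational: `p + q t = 0` with `p q : ℤ` forces `p = q = 0`. -/
theorem int_eq_zero_of_golden {K : Type*} [Field K] [CharZero K] {t : K} (ht : t * t = t + 1) (p q : ℤ)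
    (h : (p : K) + (q : K) * t = 0) : p = 0 ∧ q = 0 := by
  have hp : (p : K) = -((q : K) * t) := by linear_combination h
  have e : ((p * p + p * q - q * q : ℤ) : K) = 0 := by
    push_cast
    rw [hp]
    linear_combination ((q : K) * q) * ht
  exact int_golden_eq_zero p q (Int.cast_eq_zero.mp e)

/-- The algebra behind both reductions: `(x + y t)(z + t w) = (x z + y w) + (y z + (x + y) w) t` whenever `t * t = t + 1`. -/
theorem golden_mul_expand {R : Type*} [CommRing R] {t : R} (ht : t * t = t + 1) (x y z w : R) :
    (x + y * t) * (z + t * w) = (x * z + y * w) + (y * z + (x + y) * w) * t := by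
  linear_combination (y * w) * ht

/-- **Integral golden dependency ⟹ dependency at `ω` in characteristic 2.**  Let `t * t = t + 1` in a field `K` of characteristic
`0` and `ω * ω = ω + 1` in a field `F` of characteristic `2`.  If the integer-coordinate vector `A ↦ a_A + b_A t` (not identically
zero) is a dependency of the pencil rows of `𝒜` at `t`, then the pencil rows at `ω` have a non-zero dependency over `F`. -/
theorem exists_charTwo_dependency_of_integral_dependency (𝒜 : Finset (Finset α))
    {K : Type*} [Field K] [CharZero K] {t : K} (ht : t * t = t + 1)
    {F : Type*} [Field F] [CharP F 2] {ω : F} (hω : ω * ω = ω + 1)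
    (a b : ↥𝒜 → ℤ) (hab : ∃ A, a A ≠ 0 ∨ b A ≠ 0)
    (hdep : ∀ E ∈ 𝒜 \\ 𝒜, ∑ A : 𝒜, ((a A : K) + (b A : K) * t) *
        ((if E ⊆ (A : Finset α) then (1 : K) else 0) + t * (if Disjoint E (A : Finset α) then (1 : K) else 0)) = 0) :
    ∃ w : ↥𝒜 → F, w ≠ 0 ∧ ∀ E ∈ 𝒜 \\ 𝒜, ∑ A : 𝒜, w A *
        ((if E ⊆ (A : Finset α) then (1 : F) else 0) + ω * (if Disjoint E (A : Finset α) then (1 : F) else 0)) = 0 := by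
  classical
  -- integer incidences
  let zI : ↥𝒜 → Finset α → ℤ := fun A E => if E ⊆ (A : Finset α) then 1 else 0
  let yI : ↥𝒜 → Finset α → ℤ := fun A E => if Disjoint E (A : Finset α) then 1 else 0
  -- Step 1: the two integer identities per column
  have hPQ : ∀ (a b : ↥𝒜 → ℤ),
      (∀ E ∈ 𝒜 \\ 𝒜, ∑ A : 𝒜, ((a A : K) + (b A : K) * t) *
        ((if E ⊆ (A : Finset α) then (1 : K) else 0) + t * (if Disjoint E (A : Finset α) then (1 : K) else 0)) = 0) →
      ∀ E ∈ 𝒜 \\ 𝒜, (∑ A : 𝒜, (a A * zI A E + b A * yI A E) = 0) ∧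
        (∑ A : 𝒜, (b A * zI A E + (a A + b A) * yI A E) = 0) := by
    intro a b hd E hE
    have h := hd E hE
    have e : ∑ A : 𝒜, ((a A : K) + (b A : K) * t) *
        ((if E ⊆ (A : Finset α) then (1 : K) else 0) + t * (if Disjoint E (A : Finset α) then (1 : K) else 0)) =
        ((∑ A : 𝒜, (a A * zI A E + b A * yI A E) : ℤ) : K) +
          ((∑ A : 𝒜, (b A * zI A E + (a A + b A) * yI A E) : ℤ) : K) * t := by
      push_cast [zI, yI]
      rw [sum_mul, ← sum_add_distrib]
      refine sum_congr rfl fun A _ => ?_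
      rw [golden_mul_expand ht]
    rw [e] at h
    exact int_eq_zero_of_golden ht _ _ h
  -- Step 2: descent on the integer data alone
  suffices H : ∀ (n : ℕ) (a b : ↥𝒜 → ℤ), ∑ A : 𝒜, ((a A).natAbs + (b A).natAbs) ≤ n → (∃ A, a A ≠ 0 ∨ b A ≠ 0) →
      (∀ E ∈ 𝒜 \\ 𝒜, (∑ A : 𝒜, (a A * zI A E + b A * yI A E) = 0) ∧
        (∑ A : 𝒜, (b A * zI A E + (a A + b A) * yI A E) = 0)) →
      ∃ w : ↥𝒜 → F, w ≠ 0 ∧ ∀ E ∈ 𝒜 \\ 𝒜, ∑ A : 𝒜, w A *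
        ((if E ⊆ (A : Finset α) then (1 : F) else 0) + ω * (if Disjoint E (A : Finset α) then (1 : F) else 0)) = 0 from
    H _ a b le_rfl hab (hPQ a b hdep)
  intro n
  induction n with
  | zero =>
    intro a b hle hab _
    obtain ⟨A, hA⟩ := hab
    have h0 : (a A).natAbs + (b A).natAbs ≤ 0 :=
      le_trans (single_le_sum (f := fun A : ↥𝒜 => (a A).natAbs + (b A).natAbs) (fun _ _ => Nat.zero_le _) (mem_univ A)) hle
    omega
  | succ n ih =>
    intro a b hle hab hz
    by_cases hodd : ∃ A, ¬ (2 ∣ a A) ∨ ¬ (2 ∣ b A)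
    · -- reduce mod 2
      obtain ⟨A0, hA0⟩ := hodd
      refine ⟨fun A => (a A : F) + (b A : F) * ω, ?_, ?_⟩
      · intro hw
        have h0 := congr_fun hw A0
        simp only [Pi.zero_apply] at h0
        have two : (2 : F) = 0 := by
          have := CharP.cast_eq_zero F 2
          exact_mod_cast this
        -- parities of a A0 and b A0
        have cast_par : ∀ z : ℤ, (z : F) = if 2 ∣ z then 0 else 1 := by
          intro z
          split_ifs with hz2
          · exact (CharP.intCast_eq_zero_iff F 2 z).mpr (by exact_mod_cast hz2)
          · have h1 : (2 : ℤ) ∣ z - 1 := by omega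
            have e : ((z - 1 : ℤ) : F) = 0 := (CharP.intCast_eq_zero_iff F 2 (z - 1)).mpr (by exact_mod_cast h1)
            push_cast at e
            linear_combination e
        rw [cast_par (a A0), cast_par (b A0)] at h0
        have hω0 : ω ≠ 0 := by
          intro h; rw [h] at hω; norm_num at hω
        have hω1 : 1 + ω ≠ 0 := by
          intro h
          have e : ω = 1 := by linear_combination h - two
          rw [e] at hω
          have : (1 : F) = 0 := by linear_combination -hω
          exact one_ne_zero this
        rcases hA0 with ha | hb
        · by_cases hb2 : 2 ∣ b A0
          · simp [ha, hb2] at h0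
          · simp only [ha, hb2, if_false, one_mul] at h0
            exact hω1 h0
        · by_cases ha2 : 2 ∣ a A0
          · simp only [ha2, hb, if_true, if_false, one_mul, zero_add] at h0
            exact hω0 h0
          · simp only [ha2, hb, if_false, one_mul] at h0
            exact hω1 h0
      · intro E hE
        obtain ⟨h1, h2⟩ := hz E hE
        have e : ∑ A : 𝒜, ((a A : F) + (b A : F) * ω) *
            ((if E ⊆ (A : Finset α) then (1 : F) else 0) + ω * (if Disjoint E (A : Finset α) then (1 : F) else 0)) =
            ((∑ A : 𝒜, (a A * zI A E + b A * yI A E) : ℤ) : F) +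
              ((∑ A : 𝒜, (b A * zI A E + (a A + b A) * yI A E) : ℤ) : F) * ω := by
          push_cast [zI, yI]
          rw [sum_mul, ← sum_add_distrib]
          refine sum_congr rfl fun A _ => ?_
          rw [golden_mul_expand hω]
        rw [e, h1, h2]
        push_cast
        ring
    · -- all coordinates even: halve and recurse
      push Not at hodd
      let a' : ↥𝒜 → ℤ := fun A => a A / 2
      let b' : ↥𝒜 → ℤ := fun A => b A / 2
      have ha' : ∀ A, a A = 2 * a' A := fun A => (Int.mul_ediv_cancel' (hodd A).1).symm
      have hb' : ∀ A, b A = 2 * b' A := fun A => (Int.mul_ediv_cancel' (hodd A).2).symm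
      obtain ⟨A0, hA0⟩ := hab
      have hab' : ∃ A, a' A ≠ 0 ∨ b' A ≠ 0 := by
        refine ⟨A0, ?_⟩
        rcases hA0 with h | h
        · left; intro h'; apply h; rw [ha' A0, h']; ring
        · right; intro h'; apply h; rw [hb' A0, h']; ring
      have hle' : ∑ A : 𝒜, ((a' A).natAbs + (b' A).natAbs) ≤ n := by
        have hlt : ∑ A : 𝒜, ((a' A).natAbs + (b' A).natAbs) < ∑ A : 𝒜, ((a A).natAbs + (b A).natAbs) := by
          apply sum_lt_sum
          · intro A _
            rw [ha' A, hb' A, Int.natAbs_mul, Int.natAbs_mul]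
            simp only [Int.reduceAbs]
            omega
          · refine ⟨A0, mem_univ _, ?_⟩
            rw [ha' A0, hb' A0, Int.natAbs_mul, Int.natAbs_mul]
            simp only [Int.reduceAbs]
            have : (a' A0).natAbs ≠ 0 ∨ (b' A0).natAbs ≠ 0 := by
              rcases hab' with ⟨A1, h⟩
              rcases hA0 with h0 | h0
              · left; intro h'; apply h0; rw [ha' A0, Int.natAbs_eq_zero.mp h']; ring
              · right; intro h'; apply h0; rw [hb' A0, Int.natAbs_eq_zero.mp h']; ring
            omega
        omega
      have hz' : ∀ E ∈ 𝒜 \\ 𝒜, (∑ A : 𝒜, (a' A * zI A E + b' A * yI A E) = 0) ∧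
          (∑ A : 𝒜, (b' A * zI A E + (a' A + b' A) * yI A E) = 0) := by
        intro E hE
        obtain ⟨h1, h2⟩ := hz E hE
        have e1 : ∑ A : 𝒜, (a A * zI A E + b A * yI A E) = 2 * ∑ A : 𝒜, (a' A * zI A E + b' A * yI A E) := by
          rw [mul_sum]; refine sum_congr rfl fun A _ => ?_; rw [ha' A, hb' A]; ring
        have e2 : ∑ A : 𝒜, (b A * zI A E + (a A + b A) * yI A E) =
            2 * ∑ A : 𝒜, (b' A * zI A E + (a' A + b' A) * yI A E) := by
          rw [mul_sum]; refine sum_congr rfl fun A _ => ?_; rw [ha' A, hb' A]; ring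
        rw [e1] at h1; rw [e2] at h2
        constructor
        · rcases mul_eq_zero.mp h1 with h | h
          · norm_num at h
          · exact h
        · rcases mul_eq_zero.mp h2 with h | h
          · norm_num at h
          · exact h
      exact ih a' b' hle' hab' hz'

/-- Every element of `ℤ[t] = Algebra.adjoin ℤ {t}` is `a + b t` when `t * t = t + 1`. -/
theorem exists_int_add_int_mul_of_mem_adjoin {K : Type*} [Field K] {t : K} (ht : t * t = t + 1)
    {x : K} (hx : x ∈ Algebra.adjoin ℤ ({t} : Set K)) : ∃ a b : ℤ, x = (a : K) + (b : K) * t := by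
  refine Algebra.adjoin_induction (p := fun x _ => ∃ a b : ℤ, x = (a : K) + (b : K) * t) ?_ ?_ ?_ ?_ hx
  · intro x hx
    rw [Set.mem_singleton_iff] at hx
    subst hx
    exact ⟨0, 1, by push_cast; ring⟩
  · intro r
    exact ⟨r, 0, by simp⟩
  · rintro x y - - ⟨a, b, rfl⟩ ⟨c, d, rfl⟩
    exact ⟨a + c, b + d, by push_cast; ring⟩
  · rintro x y - - ⟨a, b, rfl⟩ ⟨c, d, rfl⟩
    refine ⟨a * c + b * d, b * c + (a + b) * d, ?_⟩
    push_cast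
    linear_combination ((b : K) * d) * ht

/-- **LEMMA R₂, golden case: CR(2)@ω ⟹ (C0) at the golden ratio.**  Let `F` be a field of characteristic `2` with `ω * ω = ω + 1`
and suppose the pencil rows of `𝒜` at `ω` are linearly independent over `F`.  Then for every field `K` of characteristic `0` and every
`t ∈ K` with `t * t = t + 1` the pencil rows of `𝒜` at `t` are linearly independent over `K`. -/
theorem linearIndependent_pencil_golden_of_charTwo (𝒜 : Finset (Finset α))
    {F : Type*} [Field F] [CharP F 2] {ω : F} (hω : ω * ω = ω + 1)
    (hF : LinearIndependent F (fun A : 𝒜 => fun E : (𝒜 \\ 𝒜 : Finset (Finset α)) =>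
      (if (E : Finset α) ⊆ (A : Finset α) then (1 : F) else 0) +
        ω * (if Disjoint (E : Finset α) (A : Finset α) then (1 : F) else 0)))
    {K : Type*} [Field K] [CharZero K] {t : K} (ht : t * t = t + 1) :
    LinearIndependent K (fun A : 𝒜 => fun E : (𝒜 \\ 𝒜 : Finset (Finset α)) =>
      (if (E : Finset α) ⊆ (A : Finset α) then (1 : K) else 0) +
        t * (if Disjoint (E : Finset α) (A : Finset α) then (1 : K) else 0)) := by
  classical
  -- the rows have coordinates in `R = ℤ[t]`
  set R : Subalgebra ℤ K := Algebra.adjoin ℤ ({t} : Set K) with hR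
  have htR : t ∈ R := Algebra.subset_adjoin (Set.mem_singleton t)
  let vR : ↥𝒜 → (𝒜 \\ 𝒜 : Finset (Finset α)) → R := fun A E =>
    ⟨(if (E : Finset α) ⊆ (A : Finset α) then (1 : K) else 0) +
        t * (if Disjoint (E : Finset α) (A : Finset α) then (1 : K) else 0),
      R.add_mem (by split_ifs <;> simp [R.one_mem, R.zero_mem]) (R.mul_mem htR (by split_ifs <;> simp [R.one_mem, R.zero_mem]))⟩
  have hv : (fun A : ↥𝒜 => algebraMap R K ∘ vR A) = (fun A : 𝒜 => fun E : (𝒜 \\ 𝒜 : Finset (Finset α)) =>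
      (if (E : Finset α) ⊆ (A : Finset α) then (1 : K) else 0) +
        t * (if Disjoint (E : Finset α) (A : Finset α) then (1 : K) else 0)) := by
    funext A E
    rfl
  rw [← hv, linearIndependent_algebraMap_comp_iff]
  -- an `R`-dependency has coordinates `a_A + b_A t`
  by_contra hdepR
  obtain ⟨g, hg, A0, hA0⟩ := Fintype.not_linearIndependent_iff.mp hdepR
  have hcoef : ∀ A : ↥𝒜, ∃ ab : ℤ × ℤ, ((g A : R) : K) = (ab.1 : K) + (ab.2 : K) * t := by
    intro A
    obtain ⟨a, b, h⟩ := exists_int_add_int_mul_of_mem_adjoin ht (g A).2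
    exact ⟨(a, b), h⟩
  choose ab hab using hcoef
  have hne : ∃ A, (ab A).1 ≠ 0 ∨ (ab A).2 ≠ 0 := by
    refine ⟨A0, ?_⟩
    by_contra h
    push Not at h
    apply hA0
    have e : ((g A0 : R) : K) = 0 := by rw [hab A0, h.1, h.2]; simp
    exact Subtype.ext e
  have hdep : ∀ E ∈ 𝒜 \\ 𝒜, ∑ A : 𝒜, (((ab A).1 : K) + ((ab A).2 : K) * t) *
      ((if E ⊆ (A : Finset α) then (1 : K) else 0) + t * (if Disjoint E (A : Finset α) then (1 : K) else 0)) = 0 := by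
    intro E hE
    have h := congr_fun hg ⟨E, hE⟩
    simp only [Finset.sum_apply, Pi.smul_apply, smul_eq_mul, Pi.zero_apply] at h
    have h' : (((∑ i : ↥𝒜, g i * vR i ⟨E, hE⟩ : R)) : K) = 0 := by rw [h]; rfl
    have e : ∑ A : 𝒜, (((ab A).1 : K) + ((ab A).2 : K) * t) *
        ((if E ⊆ (A : Finset α) then (1 : K) else 0) + t * (if Disjoint E (A : Finset α) then (1 : K) else 0)) =
        (((∑ i : ↥𝒜, g i * vR i ⟨E, hE⟩ : R)) : K) := by
      push_cast
      refine sum_congr rfl fun A _ => ?_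
      rw [hab A]
    rw [e, h']
  obtain ⟨w, hw0, hw⟩ := exists_charTwo_dependency_of_integral_dependency 𝒜 ht hω
    (fun A => (ab A).1) (fun A => (ab A).2) hne hdep
  -- contradiction with independence at `ω`
  rw [Fintype.linearIndependent_iff] at hF
  apply hw0
  funext A
  refine hF w ?_ A
  funext E
  simp only [Finset.sum_apply, Pi.smul_apply, smul_eq_mul, Pi.zero_apply]
  exact hw E E.2

end OrderedDifferences

end Summit.CriticalPhenomena.PercolationContinuityZ3.Theorems
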